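import Literature.AlgebraicGeometry.ShimuraVarieties.UnitaryBallPeriodLatticeSpan
import Literature.Geometry.Kaehler.ComplexTorusCover
import HarnessLib

/-!
# The analytic Albanese map of a compact ball quotient surface

Layer `Literature/AlgebraicGeometry/ShimuraVarieties`, sequel of `UnitaryBallPeriodLatticeSpan` (the period
group `Λ ⊆ ℂ^ι` of the holomorphic `1`-forms of `X(ℂ) = Γ \ 𝔹²` in a basis `b : Basis ι ℂ Ω¹(X^an)` is a
full lattice: `exists_periodMatrix`).  DEFINITIONS WITH BODIES + THEOREMS; no named fact.  Following
Griffiths–Harris, Ch. 2 §6 ("the Albanese map `μ : X → Alb(X) = H⁰(X, Ω¹)^* / Λ`,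
`p ↦ (∫_{p₀}^{p} ω₁, …, ∫_{p₀}^{p} ω_q)` modulo periods") and Voisin I §12.1.2:

* `albLift A 𝔣 b : 𝔹² → ℂ^ι`, `z ↦ (P₁(z), …, P_q(z))` — the holomorphic primitives of the lifted basis
  forms `ψ^* bᵢ` on the ball, normalised by `P(0) = 0` (the lift of the Albanese map to the universal
  cover); `albLift_smul`: `𝒜(γ z) = 𝒜(z) + λ(γ)` (`λ` the period vector); `albLift_mem_holomorphic`,
  `hasFDerivAt_extend_albLift` (`d𝒜 = (ψ^* b₁, …, ψ^* b_q)`);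
* `periodMatrix A 𝔣 b : ℝ^{2q} ≃L[ℝ] ℂ^ι` — a period matrix: `Φ(ℤ^{2q}) = Λ` (a CHOICE from
  `exists_periodMatrix`), and the **Albanese torus** `AlbaneseTorus := ComplexTorus (periodMatrix …)`, a
  compact complex manifold of dimension `q = h^{1,0}(X)` (`Literature.Geometry.Kaehler.ComplexTorus`);
  `cover_periodVec`: the periods die in the torus;
* `albMap A 𝔣 b : X^an → AlbaneseTorus`, `ψ(z) ↦ [𝒜(z)]` — **the Albanese map**, well defined because the
  fibres of `ψ` are the `Γ`-orbits and `𝒜(γ z) − 𝒜(z) = λ(γ) ∈ Λ` (`albMap_modelUnif`); `albMap_base`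
  (`ψ(0) ↦ 0`); **`continuous_albMap`**, **`mdifferentiable_albMap`** (holomorphic: locally
  `alb = π ∘ 𝒜 ∘ g ∘ φ` with `g` a holomorphic local inverse of `ψ` in the chart `φ`,
  `UnitaryBallLocalBiholomorphy.ChartInverse`, and `π = ComplexTorus.cover` holomorphic),
  `contMDiff_albMap`.

## References

* [GriffithsHarris1978] P. Griffiths, J. Harris, *Principles of Algebraic Geometry* (1978), Ch. 2 §6.
* [VoisinHodgeI2002] C. Voisin, *Hodge Theory and Complex Algebraic Geometry I* (2002), §12.1.2
  (Def. 12.10, Lemma 12.11: the Albanese map is holomorphic).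
* [LangeBirkenhake1992] H. Lange, Ch. Birkenhake, *Complex Abelian Varieties* (1992), §1.1, Lemma 1.1.3.
-/

noncomputable section

open Matrix MulAction Function Set Filter Module Complex
open scoped Manifold Topology TensorProduct ContDiff
open Literature.Geometry.ComplexHyperbolic
open Literature.Geometry.ComplexHyperbolic.BallModel (U21 Ball Jac x₀ nsq actVec)
open Literature.Geometry.Kaehler (MForm IsHolomorphicInCharts holFormsInCharts isOfType_of_mem
  isHolomorphicInCharts_of_mem isSmoothForm_of_mem ComplexTorus)
open Literature.NumberTheory.Transcendental
open Literature.NumberTheory.Automorphic.AutomorphyFactor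
open Literature.AlgebraicGeometry.HodgeTheory
open Literature.AlgebraicGeometry.Motives (bettiCohomology)

namespace Literature.AlgebraicGeometry.ShimuraVarieties

namespace UnitaryBallUniformisationDatum

variable {X : Motives.SchemeOver ℂ} (D : UnitaryBallUniformisationDatum 2 X) (A : HodgeModel 2 X)
  (𝔣 : D.SylvesterFrame) {ι : Type} (b : Basis ι ℂ (holFormsInCharts A.model A.carrier 1))

/-! ### The lift of the Albanese map to the ball -/

/-- **The lift `𝒜 : 𝔹² → ℂ^ι` of the Albanese map**: `𝒜(z)ᵢ = Pᵢ(z)`, the holomorphic primitive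
(`BallForms.primitive`, normalised by `Pᵢ(0) = 0`) of the lifted basis form `ψ^* bᵢ`.
[cite: GriffithsHarris1978, Ch. 2 §6] -/
def albLift (z : Ball) : ι → ℂ :=
  fun i ↦ BallForms.primitive (D.formPullback₁ A 𝔣 ((b i : holFormsInCharts A.model A.carrier 1) :
    MForm 𝓘(ℝ, A.model) A.carrier ℂ 1)) z

/-- Coordinates of the lift. [cite: GriffithsHarris1978, Ch. 2 §6] -/
theorem albLift_apply (z : Ball) (i : ι) :
    D.albLift A 𝔣 b z i = BallForms.primitive (D.formPullback₁ A 𝔣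
      ((b i : holFormsInCharts A.model A.carrier 1) : MForm 𝓘(ℝ, A.model) A.carrier ℂ 1)) z :=
  rfl

/-- `𝒜(0) = 0`. [cite: GriffithsHarris1978, Ch. 2 §6] -/
@[simp] theorem albLift_x₀ : D.albLift A 𝔣 b x₀ = 0 := by
  funext i
  simp [albLift_apply]

/-- **Equivariance of the lift**: `𝒜(γ z) = 𝒜(z) + λ(γ)`, `λ(γ)` the period vector of `γ ∈ Γ`.
[cite: GriffithsHarris1978, Ch. 2 §6] -/
theorem albLift_smul (γ : D.Γ) (z : Ball) :
    D.albLift A 𝔣 b (D.ballRep 𝔣 γ • z) = D.albLift A 𝔣 b z + D.periodVec A 𝔣 b γ := by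
  funext i
  exact D.primitive_formPullback₁_smul_eq_add_period A 𝔣 (b i) γ z

variable [Fintype ι]

/-- The lift is a holomorphic `ℂ^ι`-valued function on the ball. [cite: VoisinHodgeI2002, §12.1.2 Lemma 12.11] -/
theorem albLift_mem_holomorphic : D.albLift A 𝔣 b ∈ BallForms.holomorphic (ι → ℂ) := by
  rw [BallForms.mem_holomorphic_iff]
  refine differentiableOn_pi.2 fun i ↦ ?_
  have h := BallForms.mem_holomorphic_iff.1 (BallForms.primitive_mem_holomorphic
    (D.formPullback₁_coe_mem_holomorphic A 𝔣 (b i))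
    (isClosedForm_formPullback₁_of_mem (D := D) (A := A) (𝔣 := 𝔣) (b i)))
  refine h.congr fun w hw ↦ ?_
  rw [show w = (⟨w, hw⟩ : Ball).1 from rfl, BallForms.extend_apply_coe, BallForms.extend_apply_coe]
  rfl

/-- The lift is continuous. [cite: VoisinHodgeI2002, §12.1.2 Lemma 12.11] -/
theorem continuous_albLift : Continuous (D.albLift A 𝔣 b) :=
  BallForms.continuous_of_mem_holomorphic (D.albLift_mem_holomorphic A 𝔣 b)

/-- **`d𝒜 = (ψ^* b₁, …, ψ^* b_q)`**: the zero-extended lift has complex derivative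
`v ↦ (Σⱼ (ψ^* bᵢ)ⱼ(z) vⱼ)ᵢ` at every ball point. [cite: GriffithsHarris1978, Ch. 2 §6] -/
theorem hasFDerivAt_extend_albLift (z : Ball) :
    HasFDerivAt (BallForms.extend (ι → ℂ) (D.albLift A 𝔣 b))
      (ContinuousLinearMap.pi fun i ↦ BallForms.formCLM (D.formPullback₁ A 𝔣
        ((b i : holFormsInCharts A.model A.carrier 1) : MForm 𝓘(ℝ, A.model) A.carrier ℂ 1)) z.1) z.1 := by
  have key : BallForms.extend (ι → ℂ) (D.albLift A 𝔣 b) = fun w i ↦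
      BallForms.extend ℂ (BallForms.primitive (D.formPullback₁ A 𝔣
        ((b i : holFormsInCharts A.model A.carrier 1) : MForm 𝓘(ℝ, A.model) A.carrier ℂ 1))) w := by
    funext w i
    by_cases hw : nsq w < 1
    · rw [show w = (⟨w, hw⟩ : Ball).1 from rfl, BallForms.extend_apply_coe, BallForms.extend_apply_coe]
      rfl
    · simp [BallForms.extend, hw]
  rw [key]
  exact hasFDerivAt_pi.2 fun i ↦ BallForms.hasFDerivAt_extend_primitive
    (D.formPullback₁_coe_mem_holomorphic A 𝔣 (b i))
    (isClosedForm_formPullback₁_of_mem (D := D) (A := A) (𝔣 := 𝔣) (b i)) z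

/-! ### The Albanese torus -/

section Torus

/-- **A period matrix** `Φ : ℝ^{2q} ≃ ℂ^ι` of the period lattice (`2q = dim_ℝ ℂ^ι`): `Φ(ℤ^{2q}) = Λ`
(a choice from `exists_periodMatrix`). [cite: LangeBirkenhake1992, §1.1 (period matrices)]
[cite: GriffithsHarris1978, Ch. 2 §6] -/
def periodMatrix : (Fin (Module.finrank ℝ (ι → ℂ)) → ℝ) ≃L[ℝ] (ι → ℂ) :=
  (D.exists_periodMatrix A 𝔣 b).choose

/-- The period matrix generates exactly the period group. [cite: GriffithsHarris1978, Ch. 2 §6] -/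
theorem mem_periodLattice_iff_periodMatrix (x : ι → ℂ) :
    x ∈ D.periodLattice A 𝔣 b ↔
      ∃ v : Fin (Module.finrank ℝ (ι → ℂ)) → ℤ, D.periodMatrix A 𝔣 b (fun i ↦ (v i : ℝ)) = x :=
  (D.exists_periodMatrix A 𝔣 b).choose_spec x

/-- **The Albanese torus** `ℂ^ι / Λ` of `X` (in the basis `b` and the period matrix of record): a compact
connected complex manifold of dimension `q = h^{1,0}(X)` (`Literature.Geometry.Kaehler.ComplexTorus`).
[cite: GriffithsHarris1978, Ch. 2 §6] [cite: VoisinHodgeI2002, §12.1.2 Def. 12.10] -/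
abbrev AlbaneseTorus : Type := ComplexTorus (D.periodMatrix A 𝔣 b)

/-- Period vectors are lattice vectors of the period matrix. [cite: GriffithsHarris1978, Ch. 2 §6] -/
theorem exists_periodVec_eq_latticeVec (γ : D.Γ) :
    ∃ n : Fin (Module.finrank ℝ (ι → ℂ)) → ℤ,
      D.periodVec A 𝔣 b γ = ComplexTorus.latticeVec (D.periodMatrix A 𝔣 b) n := by
  obtain ⟨v, hv⟩ := (D.mem_periodLattice_iff_periodMatrix A 𝔣 b _).1
    (D.periodVec_mem_periodLattice A 𝔣 b γ)
  exact ⟨v, hv.symm⟩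

/-- **The periods die in the torus**: `π(w + λ(γ)) = π(w)` for the covering map `π : ℂ^ι → ℂ^ι / Λ`.
[cite: GriffithsHarris1978, Ch. 2 §6] -/
theorem cover_add_periodVec (w : ι → ℂ) (γ : D.Γ) :
    ComplexTorus.cover (D.periodMatrix A 𝔣 b) (w + D.periodVec A 𝔣 b γ) =
      ComplexTorus.cover (D.periodMatrix A 𝔣 b) w := by
  obtain ⟨n, hn⟩ := D.exists_periodVec_eq_latticeVec A 𝔣 b γ
  rw [hn, ComplexTorus.cover_add_latticeVec]

/-! ### The Albanese map -/

/-- A set-theoretic section of the uniformisation `ψ : 𝔹² → X^an` (which is onto).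
[cite: GriffithsHarris1978, Ch. 2 §6] -/
theorem exists_ballSection : ∃ s : A.carrier → Ball, ∀ x, D.modelUnif A 𝔣 (s x).1 = x :=
  ⟨fun x ↦ (D.exists_modelUnif_eq A 𝔣 x).choose, fun x ↦ (D.exists_modelUnif_eq A 𝔣 x).choose_spec⟩

/-- **The Albanese map** `alb : X^an → ℂ^ι / Λ`, `ψ(z) ↦ π(𝒜(z))` (independent of the lift `z` of the
point: `albMap_modelUnif`). [cite: GriffithsHarris1978, Ch. 2 §6] [cite: VoisinHodgeI2002, §12.1.2 Def. 12.10] -/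
def albMap (x : A.carrier) : D.AlbaneseTorus A 𝔣 b :=
  ComplexTorus.cover (D.periodMatrix A 𝔣 b) (D.albLift A 𝔣 b ((D.exists_ballSection A 𝔣).choose x))

/-- **The Albanese map on the image of a ball point**: `alb(ψ z) = π(𝒜 z)` — two lifts of `ψ z` differ by
some `γ ∈ Γ` and `𝒜(γ z) = 𝒜(z) + λ(γ)` with `π(λ(γ)) = 0`. [cite: GriffithsHarris1978, Ch. 2 §6] -/
theorem albMap_modelUnif (z : Ball) :
    D.albMap A 𝔣 b (D.modelUnif A 𝔣 z.1) =
      ComplexTorus.cover (D.periodMatrix A 𝔣 b) (D.albLift A 𝔣 b z) := by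
  set s := (D.exists_ballSection A 𝔣).choose with hs
  have hsz : D.modelUnif A 𝔣 (s (D.modelUnif A 𝔣 z.1)).1 = D.modelUnif A 𝔣 z.1 :=
    (D.exists_ballSection A 𝔣).choose_spec _
  obtain ⟨γ, hγ⟩ := (D.modelUnif_eq_iff A 𝔣 z (s (D.modelUnif A 𝔣 z.1))).1 hsz.symm
  change ComplexTorus.cover _ (D.albLift A 𝔣 b (s (D.modelUnif A 𝔣 z.1))) = _
  rw [← hγ, D.albLift_smul A 𝔣 b γ z, D.cover_add_periodVec A 𝔣 b]

/-- `alb(ψ 0) = 0`. [cite: GriffithsHarris1978, Ch. 2 §6] -/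
theorem albMap_base : D.albMap A 𝔣 b (D.modelUnif A 𝔣 x₀.1) = 0 := by
  rw [albMap_modelUnif, albLift_x₀, ComplexTorus.cover_apply, map_zero]
  funext i
  change (((0 : Fin (Module.finrank ℝ (ι → ℂ)) → ℝ) i : ℝ) : AddCircle (1 : ℝ)) = 0
  simp

/-- The uniformisation `𝔹² → X^an` (restricted to the ball type) is a quotient map. [cite: BergeronMillsonMoeglin2016Balls, Introduction §1.1] -/
theorem isQuotientMap_modelUnif_comp_coe :
    Topology.IsQuotientMap (fun z : Ball ↦ D.modelUnif A 𝔣 z.1) :=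
  A.isAnalytification.homeomorph.symm.isQuotientMap.comp (D.isQuotientMap_ballUnifMap 𝔣)

/-- **The Albanese map is continuous** (`alb ∘ ψ = π ∘ 𝒜` is, and `ψ` is a quotient map).
[cite: VoisinHodgeI2002, §12.1.2 Lemma 12.11] -/
theorem continuous_albMap : Continuous (D.albMap A 𝔣 b) := by
  rw [(D.isQuotientMap_modelUnif_comp_coe A 𝔣).continuous_iff]
  have h : D.albMap A 𝔣 b ∘ (fun z : Ball ↦ D.modelUnif A 𝔣 z.1) =
      ComplexTorus.cover (D.periodMatrix A 𝔣 b) ∘ D.albLift A 𝔣 b :=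
    funext fun z ↦ D.albMap_modelUnif A 𝔣 b z
  rw [h]
  exact (ComplexTorus.continuous_cover _).comp (D.continuous_albLift A 𝔣 b)

/-- **The Albanese map is holomorphic.** Near `x = ψ z`, `alb = π ∘ 𝒜 ∘ g ∘ φ` where `φ` is the chart of
`X^an` at `x` and `g` the holomorphic local inverse of `ψ` in that chart (`ChartInverse`); `𝒜` is
holomorphic on the ball and `π` is a local biholomorphism. [cite: VoisinHodgeI2002, §12.1.2 Lemma 12.11] -/
theorem mdifferentiable_albMap :
    MDifferentiable 𝓘(ℂ, A.model) 𝓘(ℂ, ι → ℂ) (D.albMap A 𝔣 b) := by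
  intro x
  obtain ⟨z, rfl⟩ := D.exists_modelUnif_eq A 𝔣 x
  obtain ⟨c⟩ := D.nonempty_chartInverse A 𝔣 z
  -- `alb = π ∘ 𝒜 ∘ g ∘ φ` near `ψ z`, `φ` the chart at `ψ z`, `g` the local inverse of `ψ`, `𝒜` the lift
  have hev : D.albMap A 𝔣 b =ᶠ[𝓝 (D.modelUnif A 𝔣 z.1)]
      (ComplexTorus.cover (D.periodMatrix A 𝔣 b) ∘ BallForms.extend (ι → ℂ) (D.albLift A 𝔣 b) ∘ c.g ∘
        extChartAt 𝓘(ℝ, A.model) (D.modelUnif A 𝔣 z.1)) := by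
    have h1 : ∀ᶠ x' in 𝓝 (D.modelUnif A 𝔣 z.1),
        x' ∈ (extChartAt 𝓘(ℝ, A.model) (D.modelUnif A 𝔣 z.1)).source :=
      extChartAt_source_mem_nhds (I := 𝓘(ℝ, A.model)) _
    have h2 : ∀ᶠ x' in 𝓝 (D.modelUnif A 𝔣 z.1),
        extChartAt 𝓘(ℝ, A.model) (D.modelUnif A 𝔣 z.1) x' ∈ c.W :=
      (continuousAt_extChartAt (I := 𝓘(ℝ, A.model)) _).preimage_mem_nhds
        (c.isOpen.mem_nhds c.center_mem)
    filter_upwards [h1, h2] with x' h1 h2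
    have hx' : x' = D.modelUnif A 𝔣 (c.g (extChartAt 𝓘(ℝ, A.model) (D.modelUnif A 𝔣 z.1) x')) := by
      rw [← c.symm_eq _ h2, PartialEquiv.left_inv _ h1]
    rw [congrArg (D.albMap A 𝔣 b) hx']
    change D.albMap A 𝔣 b (D.modelUnif A 𝔣 (c.gBall h2).1) =
      ComplexTorus.cover (D.periodMatrix A 𝔣 b) (BallForms.extend (ι → ℂ) (D.albLift A 𝔣 b) (c.gBall h2).1)
    rw [D.albMap_modelUnif A 𝔣 b, BallForms.extend_apply_coe]
  -- each factor is complex differentiable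
  have hφd : MDifferentiableAt 𝓘(ℂ, A.model) 𝓘(ℂ, A.model)
      (extChartAt 𝓘(ℝ, A.model) (D.modelUnif A 𝔣 z.1)) (D.modelUnif A 𝔣 z.1) :=
    mdifferentiableAt_extChartAt (I := 𝓘(ℂ, A.model)) (mem_chart_source A.model _)
  have hgd : MDifferentiableAt 𝓘(ℂ, A.model) 𝓘(ℂ, Fin 2 → ℂ) c.g
      (extChartAt 𝓘(ℝ, A.model) (D.modelUnif A 𝔣 z.1) (D.modelUnif A 𝔣 z.1)) :=
    mdifferentiableAt_iff_differentiableAt.2 (c.differentiableAt c.center_mem)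
  have h12 := hgd.comp (D.modelUnif A 𝔣 z.1) hφd
  have h𝒜d : MDifferentiableAt 𝓘(ℂ, Fin 2 → ℂ) 𝓘(ℂ, ι → ℂ) (BallForms.extend (ι → ℂ) (D.albLift A 𝔣 b))
      ((c.g ∘ extChartAt 𝓘(ℝ, A.model) (D.modelUnif A 𝔣 z.1)) (D.modelUnif A 𝔣 z.1)) := by
    rw [Function.comp_apply, c.g_center]
    exact mdifferentiableAt_iff_differentiableAt.2
      (BallForms.differentiableAt_extend (D.albLift_mem_holomorphic A 𝔣 b) z)
  have h123 := h𝒜d.comp (D.modelUnif A 𝔣 z.1) h12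
  have hπd : MDifferentiableAt 𝓘(ℂ, ι → ℂ) 𝓘(ℂ, ι → ℂ) (ComplexTorus.cover (D.periodMatrix A 𝔣 b))
      ((BallForms.extend (ι → ℂ) (D.albLift A 𝔣 b) ∘ c.g ∘
        extChartAt 𝓘(ℝ, A.model) (D.modelUnif A 𝔣 z.1)) (D.modelUnif A 𝔣 z.1)) :=
    ComplexTorus.mdifferentiable_cover _ (𝕜 := ℂ) _
  have h1234 := hπd.comp (D.modelUnif A 𝔣 z.1) h123
  exact h1234.congr_of_eventuallyEq hev

/-- **The Albanese map is a holomorphic (`C^ω`) map of complex manifolds** `X^an → ℂ^ι / Λ`.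
[cite: VoisinHodgeI2002, §12.1.2 Lemma 12.11] -/
theorem contMDiff_albMap {n : ℕ∞ω} : ContMDiff 𝓘(ℂ, A.model) 𝓘(ℂ, ι → ℂ) n (D.albMap A 𝔣 b) :=
  Literature.Geometry.Kaehler.contMDiff_of_mdifferentiable (D.mdifferentiable_albMap A 𝔣 b)

/-- The Albanese map is real `C^∞` (for the de Rham calculus). [cite: VoisinHodgeI2002, §12.1.2 Lemma 12.11] -/
theorem contMDiff_real_albMap {n : ℕ∞ω} : ContMDiff 𝓘(ℝ, A.model) 𝓘(ℝ, ι → ℂ) n (D.albMap A 𝔣 b) :=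
  Literature.Geometry.Kaehler.contMDiff_real_of_mdifferentiable (D.mdifferentiable_albMap A 𝔣 b)

end Torus

end UnitaryBallUniformisationDatum

end Literature.AlgebraicGeometry.ShimuraVarieties

end
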